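/-
Cell hodgecm-mathlib — seat A-p16 (g9).  «hinjS census» outcome (A-plan1 g7 22:43:25Z): [Liu2021] Lemma 2.4 (1) in the `AlbanesePieces`
currency WITHOUT the named fact `albanese_bettiOne_pullback_bijective` — for pieces satisfying the complex Albanese bound (R-ℂ), hence for
CURVE pieces (the GS source) and BALL-QUOTIENT SURFACE pieces (the face's target levels).  THEOREMS ONLY; 0 def / 0 fact / 0 sorry.
HC_CM is NOT proved by this file; HC_CM is proved only modulo the 7 printed citations until rung 0 closes.
-/
import Summits.HodgeConjecture.CorCM.D2Bridge.NotHJAlbStarBijectiveOfLemma24Proj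
import Summits.HodgeConjecture.CorCM.HypLiu418.AlbaneseH1ComparisonOfLemma24
import Literature.NumberTheory.Automorphic.Liu2021.Lemma24OfJacobianDimension
import Literature.AlgebraicGeometry.Motives.JacobianDimensionBettiProofs
import HarnessLib

/-!
# Lemma 2.4 (1) for chosen pieces, unconditionally: `(α_X)_x^*` is bijective on `H¹(−; ℂ)`

For `X / k` smooth projective (`k → ℂ`), an Albanese datum `a` ([Liu2021] Def. 2.3) and CHOSEN pieces with base points
`D : AlbanesePieces X` (the connected components `Y_q` of `X ⊗_k ℂ` with points `x_q`), Liu's glued morphism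
`(α_X)_x = D.albAt a : X ⊗_k ℂ ⟶ Alb_X ⊗_k ℂ` induces a BIJECTION `H¹((Alb_X ⊗ ℂ)(ℂ); ℂ) → H¹((X ⊗ ℂ)(ℂ); ℂ)` as soon as every
piece satisfies the complex Albanese bound (R-ℂ) `b₁(Y_q) ≤ 2 · dim J` for its complex Albanese data `J` — [Liu2021] Lemma 2.4 (1),
PROVED along the tree's (G)-road (`Liu2021.albanese_bettiOne_pullback_bijective_of_isProjectiveOver`, the α-compatible finite Galois
Albanese fan) through the consumer head `NotHJ.bijective_pull_desc_albOnPiece_of_lemma24Proj`, then `ℚ → ℂ` by universal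
coefficients (`HodgeTheory.bijective_complexBetti_map_of_bijective_pull`).

* `AlbanesePieces.complexBetti_map_albAt_bijective_of_finrank_le` — the statement above (twin of the CONDITIONAL
  `AlbanesePieces.complexBetti_map_albAt_bijective`, whose hypothesis `h : albanese_bettiOne_pullback_bijective` — Lemma 2.4 (1) for ALL
  proper smooth `X`, a named fact — is replaced by the per-piece bound (R-ℂ));
* `AlbanesePieces.injective_complexBetti_map_albAt_of_isSmoothProjective_one` — CURVE pieces: (R-ℂ) is `2 dim J = b₁`
  (`Motives.two_mul_dim_eq_finrank_bettiCohomology_holds`, [Milne1986JacobianVarieties] Prop. 2.1); the source-level `hinjS` of the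
  seesaw spine `Sec42Data.BettiPinning.exists_scheme_class_detecting'` for a Shimura-CURVE source;
* `AlbanesePieces.injective_complexBetti_map_albAt_of_ballDatum` / `…bijective…` — pieces carrying ball-uniformisation data
  `UnitaryBallUniformisationDatum 2 (Y_q)` (compact Picard modular surfaces): (R-ℂ) is
  `UnitaryBallUniformisationDatum.finrank_bettiCohomology_le_two_mul_dim` ([Arapura2012] Cor. 15.4.6); the target-level injectivity
  «`y ≠ 0 ⇒ cmpT y ≠ 0`» at the face's levels, whose pieces `RecordSystem.exists_pieces[_fieldRange]` hands with exactly such data.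

Design: no new definitions; the `AlbanesePieces` structure, `albAt`, `albOnPiece`, `nablaLiftPiece` are the tree's.  Sources:
[Liu2021] Lemma 2.4 (1) (FJcycle.tex l. 1210–1228), Def. 2.3; [Milne1986JacobianVarieties] Prop. 2.1; [Arapura2012] Cor. 15.4.6;
[HatcherAT2002] §3.1 (universal coefficients).
-/

set_option autoImplicit false

noncomputable section

open Function CategoryTheory CategoryTheory.Limits AlgebraicGeometry
open Literature.AlgebraicGeometry.Motives Literature.AlgebraicGeometry.HodgeTheory Literature.AlgebraicGeometry.ShimuraVarieties
open Literature.NumberTheory.Automorphic.Liu2021 Literature.NumberTheory.Automorphic.Liu2021.AppendixC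
open AbelianVariety (bcFunctor)

namespace Summit.HodgeConjecture.CorCM.D2Bridge

variable {k : Type} [Field k] [Algebra k ℂ] {X : SchemeOver k}

namespace AlbanesePieces

/-- **[Liu2021, Lemma 2.4 (1)] for chosen pieces, unconditionally**: for `X / k` smooth projective, an Albanese datum `a` and pieces with
base points `D`, if every piece satisfies the complex Albanese bound (R-ℂ) `b₁(Y_q) ≤ 2 · dim J`, then
`(α_X)_x^* : H¹((Alb_X ⊗ ℂ)(ℂ); ℂ) → H¹((X ⊗ ℂ)(ℂ); ℂ)` is a bijection — the (G)-road theorem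
`albanese_bettiOne_pullback_bijective_of_isProjectiveOver` through `NotHJ.bijective_pull_desc_albOnPiece_of_lemma24Proj` (`D.albAt a` is
that head's glued morphism by `rfl`), then `ℚ → ℂ` by universal coefficients on the compact manifolds `X_ℂ(ℂ)`, `Alb_ℂ(ℂ)`.
[cite: Liu2021, Lemma 2.4 (1) (FJcycle.tex l. 1210–1213) with proof (l. 1220–1228)] [cite: HatcherAT2002, §3.1 Thm. 3.2 and p. 198] -/
theorem complexBetti_map_albAt_bijective_of_finrank_le (D : AlbanesePieces X) (a : Albanese X)
    {d : ℕ} [SmoothOfRelativeDimension d X.hom] (hX : IsProjectiveOver X)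
    (hRC : ∀ (q : D.Ξ) (𝒥 : Jacobian (D.Y q)), Module.finrank ℚ (bettiCohomology (D.Y q) 1) ≤ 2 * 𝒥.J.dim) :
    Bijective (complexBetti.map (D.albAt a) 1).hom := by
  haveI : CharZero k := RingHom.charZero (algebraMap k ℂ)
  haveI : ∀ q, GeometricallyIrreducible (D.Y q).hom := D.geometricallyIrreducible
  -- Lemma 2.4 (1) on `H¹(−; ℚ)` for the glued `(α_X)_x`, by the (G)-road theorem at projective `X` with (R-ℂ) pieces
  have hpull : Bijective (BettiUniverse.pull (D.albAt a) 1) :=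
    NotHJ.bijective_pull_desc_albOnPiece_of_lemma24Proj albanese_bettiOne_pullback_bijective_of_isProjectiveOver
      ‹_› hX a D.Y D.inj D.isColimit D.smoothProjective hRC D.pt
  -- `ℚ → ℂ`: both sides have finite-dimensional `H₁(−; ℚ)` (compact manifolds)
  haveI : IsProper X.hom := hX.isProper
  have := smoothOfRelativeDimension_isStableUnderBaseChange d
  haveI : SmoothOfRelativeDimension d ((bcFunctor k ℂ).obj X).hom :=
    MorphismProperty.pullback_snd (P := @SmoothOfRelativeDimension d) _ _ ‹_›
  haveI : IsProper ((bcFunctor k ℂ).obj X).hom := MorphismProperty.pullback_snd (P := @IsProper) _ _ ‹_›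
  haveI := finite_singularHomology_rat_complexPoints_of_proper ((bcFunctor k ℂ).obj X) (n := d) 1
  haveI := finite_singularHomology_rat_complexPoints
    (AbelianVariety.isSmoothProjective_holds (A := a.Alb.baseChange ℂ)) 1
  exact bijective_complexBetti_map_of_bijective_pull (D.albAt a) 1 hpull

/-- **Lemma 2.4 (1), injectivity, for CURVE pieces** (a source whose complex components are smooth projective curves — e.g. a compact
Shimura curve): (R-ℂ) holds with equality `2 dim J = b₁` ([Milne1986JacobianVarieties] Prop. 2.1, the tree's
`Motives.two_mul_dim_eq_finrank_bettiCohomology_holds`).  The shape of the binder `hinjS` of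
`Sec42Data.BettiPinning.exists_scheme_class_detecting'` for `cmpS := (complexBetti.map (D.albAt a) 1).hom`.
[cite: Liu2021, Lemma 2.4 (1) (FJcycle.tex l. 1210–1213)] [cite: Milne1986JacobianVarieties, Prop. 2.1] -/
theorem injective_complexBetti_map_albAt_of_isSmoothProjective_one (D : AlbanesePieces X) (a : Albanese X)
    {d : ℕ} [SmoothOfRelativeDimension d X.hom] (hX : IsProjectiveOver X) (hcurve : ∀ q, IsSmoothProjective 1 (D.Y q)) :
    Injective (complexBetti.map (D.albAt a) 1).hom :=
  (D.complexBetti_map_albAt_bijective_of_finrank_le a (d := d) hX fun q 𝒥 =>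
    (two_mul_dim_eq_finrank_bettiCohomology_holds (D.Y q) (hcurve q) 𝒥).ge).1

/-- **Lemma 2.4 (1), bijectivity, for pieces carrying ball-uniformisation data** `UnitaryBallUniformisationDatum 2 (Y_q)` (compact Picard
modular surfaces `Γ ∖ 𝔹²`): (R-ℂ) is `UnitaryBallUniformisationDatum.finrank_bettiCohomology_le_two_mul_dim` ([Arapura2012] Cor. 15.4.6).
[cite: Liu2021, Lemma 2.4 (1) (FJcycle.tex l. 1210–1213)] [cite: Arapura2012, Cor. 15.4.6] -/
theorem complexBetti_map_albAt_bijective_of_ballDatum (D : AlbanesePieces X) (a : Albanese X)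
    {d : ℕ} [SmoothOfRelativeDimension d X.hom] (hX : IsProjectiveOver X) (B : ∀ q, UnitaryBallUniformisationDatum 2 (D.Y q)) :
    Bijective (complexBetti.map (D.albAt a) 1).hom :=
  D.complexBetti_map_albAt_bijective_of_finrank_le a (d := d) hX fun q 𝒥 => (B q).finrank_bettiCohomology_le_two_mul_dim 𝒥

/-- **Lemma 2.4 (1), injectivity, for pieces carrying ball-uniformisation data** — the target-level injectivity «`y ≠ 0 ⇒ cmpT y ≠ 0`»
for `cmpT := (complexBetti.map (D.albAt a) 1).hom` at the levels of the compact unitary Shimura surface tower, whose pieces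
`RecordSystem.exists_pieces` hands with exactly such data. [cite: Liu2021, Lemma 2.4 (1) (FJcycle.tex l. 1210–1213); §4.2 l. 2053–2074]
[cite: Arapura2012, Cor. 15.4.6] -/
theorem injective_complexBetti_map_albAt_of_ballDatum (D : AlbanesePieces X) (a : Albanese X)
    {d : ℕ} [SmoothOfRelativeDimension d X.hom] (hX : IsProjectiveOver X) (B : ∀ q, UnitaryBallUniformisationDatum 2 (D.Y q)) :
    Injective (complexBetti.map (D.albAt a) 1).hom :=
  (D.complexBetti_map_albAt_bijective_of_ballDatum a (d := d) hX B).1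

end AlbanesePieces

end Summit.HodgeConjecture.CorCM.D2Bridge

end
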